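import Literature.IUT.LogThetaLattice.BiCoresOfKitsWithRealifiedD
import Literature.IUT.LogThetaLattice.BiCoresOfKitsToy
import HarnessLib

/-!
# [IUTchIII] Thm 1.5 (v) for the companion kit `BiCoricKit.withRealifiedD`: the `ℝ_{>0}`-ORBIT COMPATIBILITY display — proof-only

Mochizuki, *Inter-universal Teichmüller Theory III*, kurims manuscript (May 2020), §1, Thm 1.5 (v) pp.50–51 («induce [cf. [IUTchII],
Corollaries 4.5, (ii); 4.10, (v)] an isomorphism of collections of data … compatible … with the `ℝ_{>0}`-orbits of the isomorphisms
of collections of data `(^{n,m}C^⊩_△, …) ⥲ (D^⊩(^{n,m}D^⊢_△), …)` obtained by applying the functorial algorithm discussed in the final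
portion of [IUTchII], Corollary 4.6, (ii) [cf. also the latter portions of [IUTchII], Corollary 4.10, (i), (v)]», p.50 last display –
p.51 l.1–17); *II* (Dec 2020) Cor 4.6 (ii) p.138, Cor 4.10 (v) p.161
l.3–9 / l.30–33. [claim: Mochizuki2012, status: disputed] (D-0012 claim key). abc-iut cell, seat abc-iut-w5-d043 (gen 4); PROOF-ONLY
complement (0 defs, 0 instances) to abc-iut-w4-d005's `BiCoresOfKitsWithRealifiedD.lean` (p433049: the companion kit
`Bk.withRealifiedD line c hc` with the [IUTchII] Cor 4.5 (ii) slot filled by `realifiedDSmall`, `Thm15vSingleIso` / `RealifiedRigidAt` /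
the orbit transport law at the real frame) — row «`BiCoricKit.withRealifiedD`» of the zone owner abc-iut-L6-t3; nothing of that file
is edited or restated.

WHAT IS ADDED (no hypothesis beyond the kit data by name):
* kit level — `withRealifiedD_realifiedKummer_map_eq_orbit`: read back in abc-iut-w4-d009's category of record `RlfData K.V` the
  Kummer datum of the companion IS the `ℝ_{>0}`-ORBIT of any isomorphism of collections of data (Cor 4.10 (v) p.161 l.3–9, not a
  quotient of it); `withRealifiedD_realified_mapIso_eq_refl`: the companion's `D^⊩(−)` kills every automorphism of a `𝒟^⊢`-prime-strip;
* real frame — `ofKits_withRealifiedD_realifiedTransport_eq_orbit`: at every pair of Hodge theaters of `StripFrame.ofKits` the bi-coric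
  realified poly-isomorphism IS the single `D^⊩(d)` AND the transported class between the Frobenius-like data
  `(^{A}C^⊩_△, …) ⥲ (^{A'}C^⊩_△, …)` is its double `ℝ_{>0}`-orbit class — abc-iut-w4-d006 / w4-d005's `realifiedTransport_eq_orbit_of_realifiedD`
  with the identity reading DISCHARGED (the Thm 1.5 (v) «compatible with the `ℝ_{>0}`-orbits» clause for the companion);
* toy identity — `KitsToy.biCoricKit_withRealifiedD`: at abc-iut-w4-d005's toy kit stack the construction with the toy's own pointed
  lines / `ρ`-scalars REPRODUCES the toy bi-coric kit ON THE NOSE (`rfl`), so every toy theorem of `BiCoresOfKitsToy` is an instance.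

Honest framing: bookkeeping over landed interfaces; which realified datum the genuine [IUTchII] Cor 4.5 (ii) / 4.6 (ii) output IS stays
abc-iut-L6-t2's input BY NAME; no side taken on [IUTchIII] Cor 3.12; typed ≠ proved; nothing here asserts that abc is proved or refuted.

v2 (gen 8, doc-only; referee abc-iut-ref-p PASS P32 row R46 micro-flag): the Thm 1.5 (v) quotations above and on
`ofKits_withRealifiedD_realifiedTransport_eq_orbit` now carry print's «of collections of data» and «obtained by applying the functorial
algorithm discussed in the final portion of» (kurims p.51 l.5–17) instead of eliding them without an ellipsis; no declaration, statement
or proof byte is changed.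
-/

noncomputable section

namespace Literature.IUT.LogThetaLattice

open CategoryTheory
open Literature.IUT.HodgeTheaters Literature.IUT.HodgeTheaters.PMBaseKit Literature.IUT.HodgeArakelov
open Literature.AnabelianGeometry.AbsoluteAnabelian AsSmallTransport

universe u

variable {l : ℕ} {K : PMBaseKit.{u} l} {M : K.MultKit} {FK : K.FKit M}

/-! ### 1. Kit level: the Kummer datum read in `RlfData` is the `ℝ_{>0}`-orbit; `D^⊩` kills automorphisms -/

namespace BiCoricKit

variable {L : FK.MonoLaws} {X : TimesMuSide FK L} (Bk : BiCoricKit X)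
  (line : M.DMono → K.V → RLine.{u}) (c : K.V → ℝ) (hc : ∀ v, 0 < c v)

/-- **IUTchII:Cor4.10(v)** (kurims p.161 l.3–9) read back in abc-iut-w4-d009's category of record `RlfData K.V` (the fully faithful induced
functor), the Kummer datum of the companion kit at a Hodge theater IS the `ℝ_{>0}`-ORBIT of any isomorphism `κ` of collections of data —
the printed orbit, not a quotient of it (abc-iut-w4-d005's `rlfImage_full_map_eq_orbit`). [claim: Mochizuki2012, status: disputed] -/
theorem withRealifiedD_realifiedKummer_map_eq_orbit (H : HTRep FK)
    (κ : (realifiedD line c hc).obj (Bk.dvDelta.obj (HTRep.toDFunctor.obj H)) ≅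
      (realifiedD line c hc).obj (Bk.dvDelta.obj (HTRep.toDFunctor.obj H))) :
    ((Bk.withRealifiedD line c hc).realifiedKummer H).map
        (inducedFunctor (fun D : M.DMono => (realifiedD line c hc).obj D)) = RlfData.orbit κ :=
  rlfImage_full_map_eq_orbit line c hc _ _ κ

/-- **IUTchII:Cor4.10(v)** (kurims p.160) / **IUTchIII:Thm1.5(v)** (p.50) the companion kit's `D^⊩(−)` KILLS every automorphism of a
`𝒟^⊢`-prime-strip — the rigidity is a property of Cor 4.5 (ii)'s FUNCTOR, the target category being the non-rigid torsor shape
(abc-iut-w4-d005's `withRealifiedD_RFrob_exists_ne_id`). [claim: Mochizuki2012, status: disputed] -/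
theorem withRealifiedD_realified_mapIso_eq_refl {A : M.DMono} (a : A ≅ A) :
    (Bk.withRealifiedD line c hc).realified.mapIso a = Iso.refl _ :=
  realifiedDSmall_mapIso_eq_refl line c hc a

/-- **IUTchII:Cor4.10(v)** (kurims p.160) … and identifies PARALLEL morphisms of `𝒟^⊢`-prime-strips («induces AN isomorphism» at kit level).
[claim: Mochizuki2012, status: disputed] -/
theorem withRealifiedD_realified_map_eq {A B : M.DMono} (f g : A ⟶ B) :
    (Bk.withRealifiedD line c hc).realified.map f = (Bk.withRealifiedD line c hc).realified.map g :=
  realifiedDSmall_map_eq line c hc f g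

end BiCoricKit

/-! ### 2. Real frame: the Thm 1.5 (v) orbit-compatibility display for the companion -/

section Frame

variable (L : FK.MonoLaws) (hbij : FK.IsomFtoDBijective) (hsurj : FK.IsomFmtoDmSurjective) (hR : FK.RlfOfIsStrip)
  (X : TimesMuSide FK L) (Bk : BiCoricKit X) (line : M.DMono → K.V → RLine.{u}) (c : K.V → ℝ) (hc : ∀ v, 0 < c v)

/-- **IUTchIII:Thm1.5(v)** (kurims p.51) / **IUTchII:Cor4.10(v)** (p.161 l.3–9) «compatible … with the `ℝ_{>0}`-orbits of the isomorphisms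
of collections of data `(^{n,m}C^⊩_△, …) ⥲ (D^⊩(^{n,m}D^⊢_△), …)` obtained by applying the functorial algorithm discussed in the final
portion of [[IUTchII],] Corollary 4.6, (ii)»: at every pair of Hodge theaters `A`, `A'` of the real frame and every `d : ^{A}𝔇^⊢_△ ≅ ^{A'}𝔇^⊢_△`,
the bi-coric realified poly-isomorphism of the companion IS the single `D^⊩(d)`, and the transported poly-isomorphism between the
Frobenius-like data is `(ℝ_{>0}-orbit at A) ∘ D^⊩(d) ∘ (ℝ_{>0}-orbit at A')⁻¹` — abc-iut-w4-d006/w4-d005's `realifiedTransport_eq_orbit_of_realifiedD`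
with the identity reading (`Φ := AsSmall.down ⋙ 𝟭`, `U := AsSmall.down ⋙ inducedFunctor`, abc-iut-w4-d009's `ofKitsRealifiedReadingIso`)
DISCHARGED. [claim: Mochizuki2012, status: disputed] -/
theorem ofKits_withRealifiedD_realifiedTransport_eq_orbit (A A' : (StripFrame.ofKits L hbij hsurj hR X).HT)
    (d : (BiCoricData.ofKits L hbij hsurj hR X (Bk.withRealifiedD line c hc)).dvDeltaOf
        ((StripFrame.ofKits L hbij hsurj hR X).htToD.obj A) ≅
      (BiCoricData.ofKits L hbij hsurj hR X (Bk.withRealifiedD line c hc)).dvDeltaOf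
        ((StripFrame.ofKits L hbij hsurj hR X).htToD.obj A')) :
    (BiCoricData.ofKits L hbij hsurj hR X (Bk.withRealifiedD line c hc)).biCoricRealifiedPolyIso
          ((StripFrame.ofKits L hbij hsurj hR X).htToD.obj A) ((StripFrame.ofKits L hbij hsurj hR X).htToD.obj A') =
        PolyIso.single ((BiCoricData.ofKits L hbij hsurj hR X (Bk.withRealifiedD line c hc)).realified.mapIso d) ∧
      (BiCoricData.ofKits L hbij hsurj hR X (Bk.withRealifiedD line c hc)).realifiedTransport A A' =
        (((BiCoricData.ofKits L hbij hsurj hR X (Bk.withRealifiedD line c hc)).realifiedKummer A).comp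
            (PolyIso.single ((BiCoricData.ofKits L hbij hsurj hR X (Bk.withRealifiedD line c hc)).realified.mapIso d))).comp
          ((BiCoricData.ofKits L hbij hsurj hR X (Bk.withRealifiedD line c hc)).realifiedKummer A').symm :=
  haveI hU : (inducedFunctor (fun D : M.DMono => (realifiedD line c hc).obj D) :
      (Bk.withRealifiedD line c hc).RFrob ⥤ RlfData.{0, u} K.V).Faithful := InducedCategory.faithful _
  have hF : (AsSmall.down ⋙ inducedFunctor (fun D : M.DMono => (realifiedD line c hc).obj D) :
      AsSmall.{max 1 u} (Bk.withRealifiedD line c hc).RFrob ⥤ RlfData.{0, u} K.V).Faithful :=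
    @Functor.Faithful.comp _ _ _ _ _ _ AsSmall.down (inducedFunctor _)
      (⟨fun hfg => ULift.ext _ _ hfg⟩ :
        (AsSmall.down : AsSmall.{max 1 u} (Bk.withRealifiedD line c hc).RFrob ⥤ (Bk.withRealifiedD line c hc).RFrob).Faithful)
      hU
  @BiCoricData.realifiedTransport_eq_orbit_of_realifiedD _
    (BiCoricData.ofKits L hbij hsurj hR X (Bk.withRealifiedD line c hc)) _ _ _ line c hc (AsSmall.down ⋙ 𝟭 _)
    (AsSmall.down ⋙ inducedFunctor (fun D : M.DMono => (realifiedD line c hc).obj D)) hF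
    (@ofKitsRealifiedReadingIso _ _ _ _ L hbij hsurj hR X (Bk.withRealifiedD line c hc) _ _ _ line c hc (𝟭 _)
      (inducedFunctor (fun D : M.DMono => (realifiedD line c hc).obj D)) hU
      (realifiedDSmallForgetIso line c hc ≪≫ (Functor.leftUnitor _).symm)) A A' d

/-- **IUTchIII:Thm1.5(v)** (kurims p.50) in particular the bi-coric realified poly-isomorphism of the companion between any two Hodge
theaters of the real frame with isomorphic `𝒟^⊢_△`-strips is a SINGLE isomorphism (the `PolyIso.single` half of the display).
[claim: Mochizuki2012, status: disputed] -/
theorem ofKits_withRealifiedD_biCoricRealifiedPolyIso_eq_single (A A' : (StripFrame.ofKits L hbij hsurj hR X).HT)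
    (d : (BiCoricData.ofKits L hbij hsurj hR X (Bk.withRealifiedD line c hc)).dvDeltaOf
        ((StripFrame.ofKits L hbij hsurj hR X).htToD.obj A) ≅
      (BiCoricData.ofKits L hbij hsurj hR X (Bk.withRealifiedD line c hc)).dvDeltaOf
        ((StripFrame.ofKits L hbij hsurj hR X).htToD.obj A')) :
    (BiCoricData.ofKits L hbij hsurj hR X (Bk.withRealifiedD line c hc)).biCoricRealifiedPolyIso
        ((StripFrame.ofKits L hbij hsurj hR X).htToD.obj A) ((StripFrame.ofKits L hbij hsurj hR X).htToD.obj A') =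
      PolyIso.single ((BiCoricData.ofKits L hbij hsurj hR X (Bk.withRealifiedD line c hc)).realified.mapIso d) :=
  (ofKits_withRealifiedD_realifiedTransport_eq_orbit L hbij hsurj hR X Bk line c hc A A' d).1

end Frame

/-! ### 3. Toy identity: the construction reproduces abc-iut-w4-d005's toy bi-coric kit -/

namespace KitsToy

variable (l : ℕ) [Fact l.Prime] (hl : l ≠ 2)

/-- **IUTchIII:Thm1.5(v)** (kurims p.50) at the toy kit stack, `withRealifiedD` with the toy's own pointed lines `toyLines` and `ρ`-scalars
`toyCoeff` REPRODUCES abc-iut-w4-d005's toy bi-coric kit `KitsToy.biCoricKit` ON THE NOSE (its realified slot was already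
`RlfImage` / `realifiedDSmall` routed through the one-object `dvDelta`). [claim: Mochizuki2012, status: disputed] -/
theorem biCoricKit_withRealifiedD :
    (biCoricKit l hl).withRealifiedD (toyLines l hl) (toyCoeff l hl) (toyCoeff_pos l hl) = biCoricKit l hl := rfl

/-- **IUTchIII:Thm1.5(v)** (kurims p.50) … hence the real-frame bi-coric data agree too: `BiCoricData.ofKits` of the companion of the toy kit
is abc-iut-w4-d005's `KitsToy.biCoricData`. [claim: Mochizuki2012, status: disputed] -/
theorem biCoricData_ofKits_withRealifiedD :
    BiCoricData.ofKits (FKit.MonoLaws.toy l hl) (FKit.isomFtoDBijective_toy l hl) (FKit.isomFmtoDmSurjective_toy l hl)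
        (FKit.rlfOfIsStrip_toy l hl) (timesMuSide l hl)
        ((biCoricKit l hl).withRealifiedD (toyLines l hl) (toyCoeff l hl) (toyCoeff_pos l hl)) =
      biCoricData l hl := rfl

/-- **IUTchIII:Thm1.5(v)** (kurims p.51) … so the orbit-compatibility display holds for abc-iut-w4-d005's toy bi-coric data at every pair of
toy Hodge theaters (instance of `ofKits_withRealifiedD_realifiedTransport_eq_orbit`; non-vacuity of the row).
[claim: Mochizuki2012, status: disputed] -/
theorem biCoricData_realifiedTransport_eq_orbit (A A' : (frame l hl).HT)
    (d : (biCoricData l hl).dvDeltaOf ((frame l hl).htToD.obj A) ≅ (biCoricData l hl).dvDeltaOf ((frame l hl).htToD.obj A')) :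
    (biCoricData l hl).biCoricRealifiedPolyIso ((frame l hl).htToD.obj A) ((frame l hl).htToD.obj A') =
        PolyIso.single ((biCoricData l hl).realified.mapIso d) ∧
      (biCoricData l hl).realifiedTransport A A' =
        (((biCoricData l hl).realifiedKummer A).comp (PolyIso.single ((biCoricData l hl).realified.mapIso d))).comp
          ((biCoricData l hl).realifiedKummer A').symm :=
  ofKits_withRealifiedD_realifiedTransport_eq_orbit (FKit.MonoLaws.toy l hl) (FKit.isomFtoDBijective_toy l hl)
    (FKit.isomFmtoDmSurjective_toy l hl) (FKit.rlfOfIsStrip_toy l hl) (timesMuSide l hl) (biCoricKit l hl)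
    (toyLines l hl) (toyCoeff l hl) (toyCoeff_pos l hl) A A' d

end KitsToy

end Literature.IUT.LogThetaLattice

end
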